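import Literature.NumberTheory.IwasawaTheory.Greenberg2006.CoinducedModuleDual
import Literature.NumberTheory.EllipticCurves.FunctionFieldBSDTateLemmaZ3Proofs
import HarnessLib

/-!
# The Pontryagin dual of a shifted endomorphism `τ_c ∘ L_* − 1` of `A ⊗ Λ^*` in Mahler
# coordinates: `(ker(τ_c L_* − 1))^∨ ≅ Λⁿ ⧸ ((1+T)^c·ᵗM − 1)·Λⁿ` — PROVED

Topic `Literature/NumberTheory/EllipticCurves` (namespace = path + `BigRepModule`). THEOREMS ONLY: no
definition, no named fact, no instance, no `sorry`. Cell `bsd-stepL` (typer lane `defn-ty1`, g10):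
the algebra of [GreenbergVatsal2000] Prop. 2.4 at a FINITELY DECOMPOSED place (module L5, step (S3),
of the discharge of the local atom `JetchevSkinnerWan2017.sigmaLocal_charIdeal_eulerFactor_mem_of_noTamagawaDefect`,
K2 support 20495), on the tree's co-induced model `BigRepModule 𝒪 p A` (smooth `p`-primary functions
`Φ : ℤ_p → A`, `T` acting as `τ₁ − 1`).

## The printed statements

* [GreenbergVatsal2000] Prop. (2.4) (arXiv:math/9906215 p. 22; Invent. Math. 142): "Let
  `P_ℓ(X) = det((1 − Frob_ℓ X)|_{(V_p)_{I_ℓ}}) ∈ 𝒪[X]`. Let `𝓟_ℓ = P_ℓ(ℓ⁻¹γ_ℓ) ∈ Λ = 𝒪[[Γ]]`, where `γ_ℓ`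
  denotes the Frobenius automorphism for `ℓ` in `Γ`. The characteristic ideal of the `Λ`-module
  `ℋ_ℓ(ℚ_∞)^` is generated by `𝓟_ℓ`." — proof (pp. 21–22): `H¹((ℚ_∞)_η, A) = H¹(Ī_ℓ, A_{J_ℓ})^{G/Ī_ℓ}`,
  "the eigenvalues of `γ_ℓ` acting on `(A_{I_ℓ}(−1)^{G/Ī_ℓ})^`".
* [CoatesSujatha2006Cyclotomic] §3.3, Lemma 3.3.4 (p. 37): the Mahler transform sends the group-like
  element `1_{ℤ_p}` to `1 + T` (so `γ^c ↦ (1+T)^c`); Thm. 3.3.3 (p. 37): `𝓜 : Λ(ℤ_p) ≅ ℤ_p⟦T⟧`.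
* [PollackWeston2011] Lemma 3.2: `ℋ_v^∨ ≅ Λ/(P_v(γ_v))`-type computations of local duals through
  `A_f ⊗ Λ^∨`.

## What is proved (for a `p`-primary `𝒪`-module `A` with a dual datum `(Y, tA)` — values in any
## abelian group `C`, later `ℚ/ℤ` — free with basis `b : Fin n`, i.e. `A` cofree of corank `n`)

The tree's `Greenberg2006/CoinducedModuleDual.lean` identifies EVERY dual of `BigRepModule 𝒪 p A` with
`Fin n → 𝒪⟦T⟧` through the Mahler pairing `seriesToDual tA b` (`⟨F, Φ⟩ = ∑ᵢ tA(∑ⱼ coeffᵢFⱼ • bⱼ)((∇ⁱΦ)(0))`).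
This file computes, in these coordinates, the dual of the endomorphisms that occur at a finitely
decomposed place:
* `shiftSubOne_pow_mapRange` — `∇ʲ (L_* Φ) = L_* (∇ʲ Φ)`;
* **`seriesToDual_mapRange`** (naturality of the Mahler pairing) — for `L : A → A` with an ADJOINT
  `Lt : Y → Y` (`tA (Lt y) a = tA y (L a)`), `⟨G, L_* Φ⟩ = ⟨ᵗM • G, Φ⟩` with
  `ᵗM = (toMatrix b b Lt).map C` (the matrix of `Lt`, constant coefficients);
* `seriesToDual_translate` — `⟨G, τ_c Φ⟩ = ⟨(1+T)^c • G, Φ⟩` (the tree's `translate_eq_binomSeries_smul`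
  and balancedness `seriesToDual_smul`);
* **`seriesToDual_shiftedEndo`** — for any `𝒪⟦T⟧`-linear `E` with `E Φ = τ_c (L_* Φ) − Φ`:
  `⟨G, E Φ⟩ = ⟨N • G, Φ⟩`, **`N = (1+T)^c · ᵗM − 1`**;
* `dual_mahlerEquiv_apply` — with `Θ : (Fin n → 𝒪⟦T⟧) ≃ₗ CharacterModule (BigRepModule 𝒪 p A)` the
  Mahler isomorphism onto Mathlib's Pontryagin dual, `E^∨ ∘ Θ = Θ ∘ N` (conjugacy);
  `map_mahlerEquiv_range_mulVecLin` — `Θ(N·Λⁿ) = range E^∨`;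
* **`nonempty_characterModule_ker_linearEquiv_quotient_range_mulVecLin`** —
  `(ker E)^∨ ≃ₗ[𝒪⟦T⟧] (Fin n → 𝒪⟦T⟧) ⧸ N·(Fin n → 𝒪⟦T⟧)` (Tate's Lemma z.3 `(ker E)^∨ ≅ coker E^∨`,
  tree `TateBourbaki.nonempty_coker_dual_equiv`, then conjugacy).
With the tree's `Matrix.finite_isTorsion_charIdeal_quotient_range_mulVecLin` (`char(Λⁿ/NΛⁿ) = (det N)`,
file `CharIdealCokernelDetProofs`) this gives `Ch_Λ((ker E)^∨) = (det((1+T)^c·ᵗM − 1))`, the shape of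
`𝓟_ℓ = det(1 − Frob·X)|_{X = ℓ⁻¹γ_ℓ}` — assembled in a two-line sibling once both files are built.

HONEST FRAMING: pure `Λ`-module algebra of the co-induced module; nothing about Galois cohomology,
elliptic curves or BSD is proved here, and the named local fact is NOT discharged by this file.

References: [GreenbergVatsal2000] Prop. 2.4 and its proof (arXiv pp. 21–22); [CoatesSujatha2006Cyclotomic]
§3.3 (Thm. 3.3.3, Lemma 3.3.4, p. 37); [PollackWeston2011] Lemma 3.2; [Greenberg2006] p. 342;
[Tate1966Bourbaki] §5 Lemma z.3. Tree: `Greenberg2006/CoinducedModuleDual.lean` (`seriesToDual`,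
`isDualPairing_seriesToDual`, `binomSeries`, `translate_eq_binomSeries_smul`), `AnticyclotomicBigGaloisRep.lean`
(`translate`, `mapRange`, `shiftSubOne`), `FunctionFieldBSDTateLemmaZ3Proofs.lean` (`TateBourbaki`).
-/

noncomputable section

open Finset PowerSeries
open Literature.NumberTheory.IwasawaTheory.Greenberg2016

universe u

namespace Literature.NumberTheory.EllipticCurves.BigRepModule

variable {𝒪 : Type u} [CommRing 𝒪] {p : ℕ} [Fact p.Prime] {A : Type u} [AddCommGroup A] [Module 𝒪 A]

/-! ## §1 `∇` and `L_*` commute -/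

/-- `∇ (L_* Φ) = L_* (∇ Φ)` (`L_*` acts on values, `∇ = τ₁ − 1` on the variable).
[cite: CoatesSujatha2006Cyclotomic, Thm. 3.3.1 (§3.3 p. 36: ∇f(x) = f(x+1) − f(x))] -/
theorem shiftSubOne_mapRange {A' : Type*} [AddCommGroup A'] [Module 𝒪 A'] (L : A →ₗ[𝒪] A')
    (Φ : BigRepModule 𝒪 p A) : shiftSubOne (mapRange L Φ) = mapRange L (shiftSubOne Φ) := by
  ext x
  rw [shiftSubOne_apply, mapRange_apply, mapRange_apply, mapRange_apply, shiftSubOne_apply, map_sub]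

/-- `∇ʲ (L_* Φ) = L_* (∇ʲ Φ)`. [cite: CoatesSujatha2006Cyclotomic, Thm. 3.3.1 (§3.3 p. 36)] -/
theorem shiftSubOne_pow_mapRange {A' : Type*} [AddCommGroup A'] [Module 𝒪 A'] (L : A →ₗ[𝒪] A')
    (j : ℕ) (Φ : BigRepModule 𝒪 p A) :
    ((shiftSubOne : BigRepModule 𝒪 p A' →ₗ[𝒪] _) ^ j) (mapRange L Φ) =
      mapRange L (((shiftSubOne : BigRepModule 𝒪 p A →ₗ[𝒪] _) ^ j) Φ) := by
  induction j generalizing Φ with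
  | zero => rfl
  | succ j ih =>
    rw [pow_succ, pow_succ, Module.End.mul_apply, Module.End.mul_apply, shiftSubOne_mapRange, ih]

/-! ## §2 Naturality of the Mahler pairing: `⟨G, L_* Φ⟩ = ⟨ᵗM • G, Φ⟩` -/

section Naturality

variable (hA : ∀ a : A, ∃ k : ℕ, p ^ k • a = 0)
  {C : Type*} [AddCommGroup C]
  {Y : Type u} [AddCommGroup Y] [Module 𝒪 Y] (tA : Y →+ (A →+ C))
  {n : ℕ} (b : Module.Basis (Fin n) 𝒪 Y)

omit [Fact p.Prime] in
/-- Coefficients of `(M.map C) • G`: `coeffᵢ((ᵗM • G)ₖ) = ∑ⱼ Mₖⱼ · coeffᵢ Gⱼ` (constant matrices act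
coefficientwise). [cite: CoatesSujatha2006Cyclotomic, Def. 3.3.2 (§3.3 p. 37)] -/
theorem coeff_map_C_mulVecLin (M : Matrix (Fin n) (Fin n) 𝒪) (G : Fin n → PowerSeries 𝒪)
    (k : Fin n) (i : ℕ) :
    PowerSeries.coeff i (((M.map (PowerSeries.C (R := 𝒪))).mulVecLin G) k) =
      ∑ j, M k j * PowerSeries.coeff i (G j) := by
  rw [Matrix.mulVecLin_apply]
  change PowerSeries.coeff i (∑ j, PowerSeries.C (M k j) * G j) = _
  rw [map_sum]
  exact Finset.sum_congr rfl fun j _ ↦ PowerSeries.coeff_C_mul _ _ _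

omit [Fact p.Prime] in
/-- **The adjoint in coordinates**: if `Lt` is adjoint to `L` for the pairing `tA`, then on the
Mahler coefficients `Lt (∑ⱼ coeffᵢ Gⱼ • bⱼ) = ∑ₖ coeffᵢ((ᵗM • G)ₖ) • bₖ` with `ᵗM = (toMatrix b b Lt).map C`.
[cite: CoatesSujatha2006Cyclotomic, Def. 3.3.2, Thm. 3.3.3 (§3.3 p. 37)] -/
theorem adjoint_seriesCoeff (Lt : Y →ₗ[𝒪] Y) (G : Fin n → PowerSeries 𝒪) (i : ℕ) :
    Lt (seriesCoeff b G i) =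
      seriesCoeff b (((LinearMap.toMatrix b b Lt).map (PowerSeries.C (R := 𝒪))).mulVecLin G) i := by
  classical
  -- expand `Lt (b j)` in the basis `b`
  have hLt : ∀ j, Lt (b j) = ∑ k, LinearMap.toMatrix b b Lt k j • b k := fun j ↦ by
    conv_lhs => rw [← b.sum_repr (Lt (b j))]
    exact Finset.sum_congr rfl fun k _ ↦ by rw [LinearMap.toMatrix_apply]
  have lhs : Lt (seriesCoeff b G i) =
      ∑ k, (∑ j, PowerSeries.coeff i (G j) * LinearMap.toMatrix b b Lt k j) • b k := by
    rw [seriesCoeff, map_sum]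
    simp_rw [LinearMap.map_smul, hLt, Finset.smul_sum, smul_smul]
    rw [Finset.sum_comm]
    simp_rw [Finset.sum_smul]
  rw [lhs, seriesCoeff]
  refine Finset.sum_congr rfl fun k _ ↦ ?_
  rw [coeff_map_C_mulVecLin]
  congr 1
  exact Finset.sum_congr rfl fun j _ ↦ mul_comm _ _

/-- **Naturality of the Mahler pairing in the coefficients.** For an `𝒪`-linear `L : A → A` with an
adjoint `Lt : Y → Y` (`tA (Lt y) a = tA y (L a)`), pairing `G ∈ Y⟦T⟧ ≅ (Fin n → 𝒪⟦T⟧)` against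
`L_* Φ` is pairing `ᵗM • G` against `Φ`, where `ᵗM = (toMatrix b b Lt).map C` is the (constant)
matrix of `Lt` in the basis `b`: the dual of `L_* = L ⊗ 1` on `A ⊗ Λ^*` is `ᵗL ⊗ 1` on `T_A ⊗ Λ`.
[cite: CoatesSujatha2006Cyclotomic, Def. 3.3.2, Thm. 3.3.3 (§3.3 p. 37)]
[cite: GreenbergVatsal2000, proof of Prop. 2.4 (arXiv p. 22: the action of Frob_ℓ on A_{I_ℓ}(−1)^)] -/
theorem seriesToDual_mapRange (L : A →ₗ[𝒪] A) (Lt : Y →ₗ[𝒪] Y)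
    (hLt : ∀ (y : Y) (a : A), tA (Lt y) a = tA y (L a)) (G : Fin n → PowerSeries 𝒪)
    (Φ : BigRepModule 𝒪 p A) :
    seriesToDual tA b G (mapRange L Φ) =
      seriesToDual tA b (((LinearMap.toMatrix b b Lt).map (PowerSeries.C (R := 𝒪))).mulVecLin G) Φ := by
  have hN := nilIndex_spec Φ
  have hN' : ((shiftSubOne : BigRepModule 𝒪 p A →ₗ[𝒪] _) ^ nilIndex Φ) (mapRange L Φ) = 0 := by
    rw [shiftSubOne_pow_mapRange, hN, map_zero]
  rw [seriesToDual_apply tA b G hN', seriesToDual_apply tA b _ hN]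
  refine Finset.sum_congr rfl fun i _ ↦ ?_
  rw [shiftSubOne_pow_mapRange, mapRange_apply, ← hLt, adjoint_seriesCoeff b Lt G i]

end Naturality

/-! ## §3 The shifted endomorphism `E = τ_c ∘ L_* − 1` in Mahler coordinates -/

section Shifted

variable [Algebra ℤ_[p] 𝒪] (hA : ∀ a : A, ∃ k : ℕ, p ^ k • a = 0)
  {C : Type*} [AddCommGroup C]
  {Y : Type u} [AddCommGroup Y] [Module 𝒪 Y] {tA : Y →+ (A →+ C)} (hY : IsDualPairing 𝒪 A tA)
  {n : ℕ} (b : Module.Basis (Fin n) 𝒪 Y)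

include hY in
/-- `⟨G, τ_c Φ⟩ = ⟨(1+T)^c • G, Φ⟩`: translation by `c ∈ ℤ_p` is multiplication by the binomial series
`(1+T)^c` (tree `translate_eq_binomSeries_smul`) and the pairing is `𝒪⟦T⟧`-balanced.
[cite: CoatesSujatha2006Cyclotomic, Lemma 3.3.4 (§3.3 p. 37: 1_{ℤ_p} ↦ 1 + T)] -/
theorem seriesToDual_translate (c : ℤ_[p]) (G : Fin n → PowerSeries 𝒪) (Φ : BigRepModule 𝒪 p A) :
    seriesToDual tA b G (translate c Φ) = seriesToDual tA b (binomSeries 𝒪 c • G) Φ := by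
  rw [translate_eq_binomSeries_smul, seriesToDual_smul b hY]

include hY in
/-- **The shifted endomorphism in Mahler coordinates.** For any `𝒪⟦T⟧`-linear endomorphism `E` of
`A ⊗ Λ^*` with `E Φ = τ_c (L_* Φ) − Φ` (`L : A → A` with adjoint `Lt` on `Y = T_A`), pairing `G`
against `E Φ` is pairing `N • G` against `Φ`, with **`N = (1+T)^c · ᵗM − 1`**, `ᵗM = (toMatrix b b Lt).map C`
— the transpose of `γ_ℓ^c · Frob − 1` acting on `T_A ⊗ Λ`.
[cite: GreenbergVatsal2000, Prop. 2.4 and proof (arXiv pp. 21–22: 𝓟_ℓ = det(1 − Frob_ℓ X)|_{X=ℓ⁻¹γ_ℓ}, eigenvalues of γ_ℓ on (A_{I_ℓ}(−1))^)]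
[cite: CoatesSujatha2006Cyclotomic, Lemma 3.3.4 (§3.3 p. 37)] -/
theorem seriesToDual_shiftedEndo (L : A →ₗ[𝒪] A) (Lt : Y →ₗ[𝒪] Y)
    (hLt : ∀ (y : Y) (a : A), tA (Lt y) a = tA y (L a)) (c : ℤ_[p])
    (E : BigRepModule 𝒪 p A →ₗ[PowerSeries 𝒪] BigRepModule 𝒪 p A)
    (hE : ∀ Φ, E Φ = translate c (mapRange L Φ) - Φ) (G : Fin n → PowerSeries 𝒪)
    (Φ : BigRepModule 𝒪 p A) :
    seriesToDual tA b G (E Φ) =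
      seriesToDual tA b
        ((binomSeries 𝒪 c • (LinearMap.toMatrix b b Lt).map (PowerSeries.C (R := 𝒪)) - 1).mulVecLin G)
        Φ := by
  rw [hE, map_sub, seriesToDual_translate hY b, seriesToDual_mapRange tA b L Lt hLt,
    Matrix.mulVecLin_apply, Matrix.mulVecLin_apply, Matrix.sub_mulVec, Matrix.one_mulVec,
    Matrix.smul_mulVec, ← Matrix.mulVec_smul, map_sub, AddMonoidHom.sub_apply]

end Shifted

/-! ## §4 Conjugacy with `N` on Mathlib's Pontryagin dual and the dual of the kernel -/

section Dual

variable [Algebra ℤ_[p] 𝒪] (hA : ∀ a : A, ∃ k : ℕ, p ^ k • a = 0)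
  {Y : Type u} [AddCommGroup Y] [Module 𝒪 Y] {tA : Y →+ (A →+ AddCircle (1 : ℚ))}
  (hY : IsDualPairing 𝒪 A tA) {n : ℕ} (b : Module.Basis (Fin n) 𝒪 Y)

omit [Algebra ℤ_[p] 𝒪] in
/-- The Mahler isomorphism onto Mathlib's Pontryagin dual IS the pairing:
`Θ G = ⟨G, ·⟩` for `Θ = (isDualPairing_seriesToDual …).linearEquiv (isDualPairing_characterModule …)`.
[cite: CoatesSujatha2006Cyclotomic, Def. 3.3.2, Thm. 3.3.3 (§3.3 p. 37)] -/
theorem mahlerEquiv_apply (G : Fin n → PowerSeries 𝒪) :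
    (isDualPairing_seriesToDual hA b hY).linearEquiv
        (isDualPairing_characterModule (PowerSeries 𝒪) (BigRepModule 𝒪 p A)) G =
      seriesToDual tA b G :=
  (isDualPairing_seriesToDual hA b hY).toDual_linearEquiv
    (isDualPairing_characterModule (PowerSeries 𝒪) (BigRepModule 𝒪 p A)) G

/-- **Conjugacy: `E^∨ ∘ Θ = Θ ∘ N`.** Under the Mahler isomorphism
`Θ : (Fin n → 𝒪⟦T⟧) ≃ₗ (A ⊗ Λ^*)^∨`, the Pontryagin dual `E^∨ = Hom(E, ℚ/ℤ)` of `E = τ_c ∘ L_* − 1` is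
multiplication by the matrix `N = (1+T)^c · ᵗM − 1`.
[cite: GreenbergVatsal2000, Prop. 2.4 and proof (arXiv pp. 21–22)]
[cite: CoatesSujatha2006Cyclotomic, Lemma 3.3.4 (§3.3 p. 37)] -/
theorem dual_mahlerEquiv_apply (L : A →ₗ[𝒪] A) (Lt : Y →ₗ[𝒪] Y)
    (hLt : ∀ (y : Y) (a : A), tA (Lt y) a = tA y (L a)) (c : ℤ_[p])
    (E : BigRepModule 𝒪 p A →ₗ[PowerSeries 𝒪] BigRepModule 𝒪 p A)
    (hE : ∀ Φ, E Φ = translate c (mapRange L Φ) - Φ) (G : Fin n → PowerSeries 𝒪) :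
    CharacterModule.dual E
        ((isDualPairing_seriesToDual hA b hY).linearEquiv
          (isDualPairing_characterModule (PowerSeries 𝒪) (BigRepModule 𝒪 p A)) G) =
      (isDualPairing_seriesToDual hA b hY).linearEquiv
          (isDualPairing_characterModule (PowerSeries 𝒪) (BigRepModule 𝒪 p A))
        ((binomSeries 𝒪 c • (LinearMap.toMatrix b b Lt).map (PowerSeries.C (R := 𝒪)) - 1).mulVecLin
          G) := by
  apply DFunLike.ext
  intro Φ
  rw [CharacterModule.dual_apply, mahlerEquiv_apply hA hY b, mahlerEquiv_apply hA hY b]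
  exact seriesToDual_shiftedEndo hY b L Lt hLt c E hE G Φ

/-- **`Θ (N · Λⁿ) = E^∨((A ⊗ Λ^*)^∨)`**: the Mahler isomorphism carries the column space of `N` onto
the range of `E^∨`. [cite: GreenbergVatsal2000, Prop. 2.4 and proof (arXiv pp. 21–22)] -/
theorem map_mahlerEquiv_range_mulVecLin (L : A →ₗ[𝒪] A) (Lt : Y →ₗ[𝒪] Y)
    (hLt : ∀ (y : Y) (a : A), tA (Lt y) a = tA y (L a)) (c : ℤ_[p])
    (E : BigRepModule 𝒪 p A →ₗ[PowerSeries 𝒪] BigRepModule 𝒪 p A)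
    (hE : ∀ Φ, E Φ = translate c (mapRange L Φ) - Φ) :
    (LinearMap.range
        ((binomSeries 𝒪 c • (LinearMap.toMatrix b b Lt).map (PowerSeries.C (R := 𝒪)) - 1).mulVecLin)).map
        ((isDualPairing_seriesToDual hA b hY).linearEquiv
          (isDualPairing_characterModule (PowerSeries 𝒪) (BigRepModule 𝒪 p A)) :
            (Fin n → PowerSeries 𝒪) →ₗ[PowerSeries 𝒪] CharacterModule (BigRepModule 𝒪 p A)) =
      LinearMap.range (CharacterModule.dual E) := by
  set Θ := (isDualPairing_seriesToDual hA b hY).linearEquiv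
    (isDualPairing_characterModule (PowerSeries 𝒪) (BigRepModule 𝒪 p A)) with hΘ
  set N := (binomSeries 𝒪 c • (LinearMap.toMatrix b b Lt).map (PowerSeries.C (R := 𝒪)) - 1) with hNdef
  have hconj : CharacterModule.dual E ∘ₗ (Θ : (Fin n → PowerSeries 𝒪) →ₗ[PowerSeries 𝒪] _) =
      (Θ : (Fin n → PowerSeries 𝒪) →ₗ[PowerSeries 𝒪] _) ∘ₗ N.mulVecLin := by
    apply LinearMap.ext
    intro G
    rw [LinearMap.comp_apply, LinearMap.comp_apply, LinearEquiv.coe_coe]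
    exact dual_mahlerEquiv_apply hA hY b L Lt hLt c E hE G
  rw [← LinearMap.range_comp, ← hconj, LinearMap.range_comp, LinearEquiv.range, Submodule.map_top]

/-- **The dual of the kernel of a shifted endomorphism, in Mahler coordinates**: for `A` `p`-primary
and cofree of corank `n` (Pontryagin dual datum `(Y, tA)` free with basis `b`), `L : A → A` with
adjoint `Lt`, `c ∈ ℤ_p`, and any `𝒪⟦T⟧`-linear `E` with `E Φ = τ_c (L_* Φ) − Φ`:
`(ker E)^∨ ≃ₗ[𝒪⟦T⟧] (Fin n → 𝒪⟦T⟧) ⧸ N · (Fin n → 𝒪⟦T⟧)`, `N = (1+T)^c · ᵗM − 1`,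
`ᵗM = (toMatrix b b Lt).map C` — Tate's `(ker E)^∨ ≅ coker E^∨` (`TateBourbaki.nonempty_coker_dual_equiv`)
followed by the conjugacy `E^∨ ≃ N`. With `char(Λⁿ ⧸ NΛⁿ) = (det N)` this is the characteristic ideal
`(det((1+T)^c · ᵗM − 1))` of [GreenbergVatsal2000] Prop. 2.4 (`𝓟_ℓ = det(1 − Frob_ℓ X)|_{X = ℓ⁻¹γ_ℓ}`).
[cite: GreenbergVatsal2000, Prop. 2.4 and proof (arXiv pp. 21–22)]
[cite: Tate1966Bourbaki, §5, Lemma z.3 (p. 21)] -/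
theorem nonempty_characterModule_ker_linearEquiv_quotient_range_mulVecLin
    (hA : ∀ a : A, ∃ k : ℕ, p ^ k • a = 0) (hY : IsDualPairing 𝒪 A tA) (b : Module.Basis (Fin n) 𝒪 Y)
    (L : A →ₗ[𝒪] A)
    (Lt : Y →ₗ[𝒪] Y) (hLt : ∀ (y : Y) (a : A), tA (Lt y) a = tA y (L a)) (c : ℤ_[p])
    (E : BigRepModule 𝒪 p A →ₗ[PowerSeries 𝒪] BigRepModule 𝒪 p A)
    (hE : ∀ Φ, E Φ = translate c (mapRange L Φ) - Φ) :
    Nonempty (CharacterModule (LinearMap.ker E) ≃ₗ[PowerSeries 𝒪]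
      ((Fin n → PowerSeries 𝒪) ⧸ LinearMap.range
        ((binomSeries 𝒪 c • (LinearMap.toMatrix b b Lt).map (PowerSeries.C (R := 𝒪)) - 1).mulVecLin))) := by
  obtain ⟨e₁⟩ := TateBourbaki.nonempty_coker_dual_equiv (R := PowerSeries 𝒪) E
  set Θ := (isDualPairing_seriesToDual hA b hY).linearEquiv
    (isDualPairing_characterModule (PowerSeries 𝒪) (BigRepModule 𝒪 p A)) with hΘ
  have e₂ := Submodule.Quotient.equiv
    (LinearMap.range
      ((binomSeries 𝒪 c • (LinearMap.toMatrix b b Lt).map (PowerSeries.C (R := 𝒪)) - 1).mulVecLin))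
    (LinearMap.range (CharacterModule.dual E)) Θ
    (map_mahlerEquiv_range_mulVecLin hA hY b L Lt hLt c E hE)
  exact ⟨e₁.symm.trans e₂.symm⟩

end Dual

end Literature.NumberTheory.EllipticCurves.BigRepModule
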